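import Literature.Dynamics.Contraction.ComplexConeContraction

/-!
# Dubois 2009, Theorem 2.3 (contraction principle for `δ_C`) — proof

Discharges the named fact `Literature.Dynamics.Contraction.Dubois2009_thm_2_3` of
`Literature/Dynamics/Contraction/ComplexConeContraction.lean` (statement unchanged there) by
`Dubois2009_thm_2_3_holds`, following the printed proof of

* L. Dubois, *Projective metrics and contraction principles for complex cones*, J. London Math.
  Soc. (2) 79 (2009) 719–737 = arXiv:0811.2930 [Dubois2009], Theorem 2.3, proof pp. 7–8 of the
  arXiv text (read 2026-08-15 on the held copy).

Architecture (printed proof ↦ declarations here).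
* "We may assume `Tx, Ty` independent and `δ_{C₁}(x,y) < ∞`" ↦ the case splits at the top of
  `duboisDelta_map_le_tanh_mul` (`linearIndependent_of_map`, `duboisDelta_nonneg`; the value `⊤`
  of `δ_{C₁}` makes the bound trivial since `tanh(Δ/4) > 0` once `Δ > 0`, and `Δ ≥ δ(Tx,Tx) = 0`
  with equality forcing `δ_{C₂}(Tx,Ty) ≤ 0`).
* "`E_{C₂}(Tx,Ty) ⊆ E_{C₁}(x,y)`" ↦ `hsub` (needs `zx − y ≠ 0`:
  `smul_sub_ne_zero_of_linearIndependent`); "by properness `E ≠ ∅`" ↦ `duboisE_nonempty`.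
* The Möbius transformation `h(z) = (zλ − μ)/(z − 1)` and
  "`(μ−α)/(λ−α), (μ−β)/(λ−β) ∈ E_{C₂}(T(λx−y), T(μx−y))`" ↦ `div_mem_duboisE`
  (the identity `w(λu − v) − (μu − v) = (w − 1)(αu − v)`), `linearIndependent_smul_sub`.
* (2.12) `|(μ−α)/(λ−α) · (λ−β)/(μ−β)| ≤ e^Δ` ↦ `norm_le_exp_mul_norm_of_duboisDelta_le`.
* (2.13): print maps the circles `C(0,m)`, `C(0,M)` by Möbius maps and then bounds the optimum
  from below by `(A+m)(B−m)` and `(M−A)(M+B)`; the SAME endpoint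
  `(M−A)(B−m) ≤ e^Δ (A−m)(M−B)` is reached directly with `λ = mα/|α|`, `μ = Mβ/|β|`
  (`|λ−α| = A−m`, `|μ−β| = M−B`, `|μ−α| ≥ M−A`, `|λ−β| ≥ B−m`), which is what we do (`h213`).
* "back to the case of the Hilbert metric … `φ` has a minimum at `t₀` … `tanh(d/4) ≤
  tanh(Δ/4) tanh(D/4)`, so `d ≤ tanh(Δ/4) D`" ↦ `log_sub_log_le_tanh_mul`, proved from the
  polynomial identity
  `(aq−bp)²(q²−a²)(b²−p²) − (bq−ap)²(a²−p²)(q²−b²) = (ab−pq)²(q²−p²)(b²−a²)` (square-root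
  variables; it encodes `φ(A) ≥ φ(t₀)`) and the termwise comparison of the artanh series
  `Real.hasSum_log_sub_log_of_abs_lt_one` (`log_add_sub_log_sub_mul_le`, replacing the concavity
  of `tanh` used implicitly in print for the last "so").
* The passage from radii `m < inf|E₁|`, `M > sup|E₁|` and points `α, β ∈ E₂` to
  `log(sup|E₂|/inf|E₂|) ≤ tanh(Δ/4) log(sup|E₁|/inf|E₁|)` is order bookkeeping
  (`le_of_forall_pos_lt_add`, `iSup₂_le`, `le_iInf₂`) pushed through `ENNReal.log`.
Completeness of `V₁, V₂` (in the fact's binders) is not used, as in print.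

## References
* [Dubois2009] L. Dubois, J. London Math. Soc. (2) 79 (2009) 719–737 = arXiv:0811.2930,
  Def. 2, Thm 2.3, (2.11)–(2.13), Remark 1, pp. 5, 7–8.
-/

noncomputable section

open scoped ENNReal
open Set

namespace Literature.Dynamics.Contraction

/-! ### Step A: the real-variable endgame (Dubois 2009, p. 8, after (2.13)) -/

/-- `tanh t = (e^{2t} − 1)/(e^{2t} + 1)`. [folklore] -/
theorem tanh_eq_exp_two_mul (t : ℝ) :
    Real.tanh t = (Real.exp (2 * t) - 1) / (Real.exp (2 * t) + 1) := by
  rw [Real.tanh_eq, Real.exp_neg]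
  have h2 : Real.exp (2 * t) = Real.exp t * Real.exp t := by rw [← Real.exp_add]; ring_nf
  rw [h2]
  have := Real.exp_pos t
  field_simp

/-- `tanh t > 0` for `t > 0`. [folklore] -/
theorem tanh_pos_of_pos {t : ℝ} (ht : 0 < t) : 0 < Real.tanh t := by
  rw [tanh_eq_exp_two_mul]
  exact div_pos (sub_pos.2 (Real.one_lt_exp_iff.2 (by linarith))) (by positivity)

/-- Termwise comparison of the artanh series: for `0 ≤ τ ≤ 1` and `0 ≤ w < 1`,
`log(1+τw) − log(1−τw) ≤ τ (log(1+w) − log(1−w))` (i.e. `artanh (τ w) ≤ τ artanh w`). [folklore] -/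
theorem log_add_sub_log_sub_mul_le {τ w : ℝ} (hτ0 : 0 ≤ τ) (hτ1 : τ ≤ 1) (hw0 : 0 ≤ w)
    (hw1 : w < 1) :
    Real.log (1 + τ * w) - Real.log (1 - τ * w) ≤
      τ * (Real.log (1 + w) - Real.log (1 - w)) := by
  have hw : |w| < 1 := by rwa [abs_of_nonneg hw0]
  have hτw : |τ * w| < 1 := by
    rw [abs_of_nonneg (mul_nonneg hτ0 hw0)]
    calc τ * w ≤ 1 * w := by gcongr
      _ < 1 := by rw [one_mul]; exact hw1
  have h1 := Real.hasSum_log_sub_log_of_abs_lt_one hτw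
  have h2 := (Real.hasSum_log_sub_log_of_abs_lt_one hw).mul_left τ
  refine hasSum_le (fun k => ?_) h1 h2
  have hk : (0 : ℝ) ≤ 2 * (1 / (2 * k + 1)) := by positivity
  calc 2 * (1 / (2 * (k : ℝ) + 1)) * (τ * w) ^ (2 * k + 1)
      = 2 * (1 / (2 * (k : ℝ) + 1)) * (τ ^ (2 * k + 1) * w ^ (2 * k + 1)) := by rw [mul_pow]
    _ ≤ 2 * (1 / (2 * (k : ℝ) + 1)) * (τ * w ^ (2 * k + 1)) := by
        gcongr
        exact pow_le_of_le_one hτ0 hτ1 (by omega)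
    _ = τ * (2 * (1 / (2 * (k : ℝ) + 1)) * w ^ (2 * k + 1)) := by ring

/-- The one-dimensional (Hilbert-metric) endgame of the proof of Dubois 2009, Thm 2.3 (p. 8, from
(2.13) on), in square-root variables: if `0 < p < a < b < q` and
`(q² − a²)(b² − p²) ≤ e^Δ (a² − p²)(q² − b²)` then `log b − log a ≤ tanh(Δ/4) (log q − log p)`.
The printed proof minimises an auxiliary function `φ`; here the same bound comes from the
polynomial identity
`(aq−bp)²(q²−a²)(b²−p²) − (bq−ap)²(a²−p²)(q²−b²) = (ab−pq)²(q²−p²)(b²−a²) ≥ 0`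
followed by the artanh-series comparison `log_add_sub_log_sub_mul_le` (in place of the concavity
of `tanh`). [cite: Dubois2009, proof of Thm 2.3, (2.13)] -/
theorem log_sub_log_le_tanh_mul {p a b q Δ : ℝ} (hp : 0 < p) (hpa : p < a) (hab : a < b)
    (hbq : b < q)
    (h : (q ^ 2 - a ^ 2) * (b ^ 2 - p ^ 2) ≤ Real.exp Δ * ((a ^ 2 - p ^ 2) * (q ^ 2 - b ^ 2))) :
    Real.log b - Real.log a ≤ Real.tanh (Δ / 4) * (Real.log q - Real.log p) := by
  have ha : 0 < a := hp.trans hpa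
  have hb : 0 < b := ha.trans hab
  have hq : 0 < q := hb.trans hbq
  set κ := Real.exp (Δ / 2) with hκ
  have hκpos : 0 < κ := Real.exp_pos _
  have hκ2 : Real.exp Δ = κ ^ 2 := by rw [hκ, sq, ← Real.exp_add]; ring_nf
  have hX : 0 < a * q - b * p := by nlinarith
  have hY : 0 < b * q - a * p := by nlinarith
  have hD : 0 < (a ^ 2 - p ^ 2) * (q ^ 2 - b ^ 2) := by
    apply mul_pos <;> nlinarith
  -- Step 1: `bq − ap ≤ κ (aq − bp)`.
  have hid : (a * q - b * p) ^ 2 * ((q ^ 2 - a ^ 2) * (b ^ 2 - p ^ 2)) -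
      (b * q - a * p) ^ 2 * ((a ^ 2 - p ^ 2) * (q ^ 2 - b ^ 2)) =
      (a * b - p * q) ^ 2 * (q ^ 2 - p ^ 2) * (b ^ 2 - a ^ 2) := by ring
  have hstep1 : b * q - a * p ≤ κ * (a * q - b * p) := by
    have hsq : (b * q - a * p) ^ 2 ≤ (κ * (a * q - b * p)) ^ 2 := by
      rw [mul_pow, ← hκ2]
      have h1 : (b * q - a * p) ^ 2 * ((a ^ 2 - p ^ 2) * (q ^ 2 - b ^ 2)) ≤
          (a * q - b * p) ^ 2 * ((q ^ 2 - a ^ 2) * (b ^ 2 - p ^ 2)) := by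
        have : 0 ≤ (a * b - p * q) ^ 2 * (q ^ 2 - p ^ 2) * (b ^ 2 - a ^ 2) := by
          apply mul_nonneg (mul_nonneg (sq_nonneg _) _) <;> nlinarith
        linarith
      have h2 : (a * q - b * p) ^ 2 * ((q ^ 2 - a ^ 2) * (b ^ 2 - p ^ 2)) ≤
          (a * q - b * p) ^ 2 * (Real.exp Δ * ((a ^ 2 - p ^ 2) * (q ^ 2 - b ^ 2))) :=
        mul_le_mul_of_nonneg_left h (sq_nonneg _)
      have h3 : (b * q - a * p) ^ 2 * ((a ^ 2 - p ^ 2) * (q ^ 2 - b ^ 2)) ≤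
          (Real.exp Δ * (a * q - b * p) ^ 2) * ((a ^ 2 - p ^ 2) * (q ^ 2 - b ^ 2)) := by
        calc _ ≤ _ := h1.trans h2
          _ = _ := by ring
      exact le_of_mul_le_mul_right h3 hD
    exact (pow_le_pow_iff_left₀ hY.le (by positivity) two_ne_zero).1 hsq
  -- Step 2: `tanh(Δ/4) = (κ−1)/(κ+1)` dominates `c = (b−a)(q+p)/((b+a)(q−p))`.
  have hτ : Real.tanh (Δ / 4) = (κ - 1) / (κ + 1) := by
    rw [tanh_eq_exp_two_mul, show (2 : ℝ) * (Δ / 4) = Δ / 2 by ring]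
  have hκ1 : 1 < κ := by
    by_contra hle
    have hle := not_lt.1 hle
    nlinarith [mul_pos (sub_pos.2 hab) hq, mul_pos (sub_pos.2 hab) hp,
      mul_nonneg (sub_nonneg.2 hle) hX.le]
  set τ := Real.tanh (Δ / 4) with hτdef
  have hτ0 : 0 ≤ τ := by rw [hτ]; exact div_nonneg (by linarith) (by linarith)
  have hτ1 : τ ≤ 1 := by rw [hτ, div_le_one (by linarith)]; linarith
  set wd := (b - a) / (b + a) with hwd
  set wD := (q - p) / (q + p) with hwD
  have hwd0 : 0 ≤ wd := div_nonneg (by linarith) (by linarith)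
  have hwd1 : wd < 1 := by rw [hwd, div_lt_one (by linarith)]; linarith
  have hwD0 : 0 ≤ wD := div_nonneg (by linarith) (by linarith)
  have hwD1 : wD < 1 := by rw [hwD, div_lt_one (by linarith)]; linarith
  have hcmp : wd ≤ τ * wD := by
    rw [hτ, hwd, hwD, div_mul_div_comm, div_le_div_iff₀ (by linarith) (by positivity)]
    nlinarith [mul_pos (by linarith : (0 : ℝ) < b + a) (by linarith : (0 : ℝ) < q + p)]
  -- Step 3: rewrite both logarithmic differences through `wd`, `wD`.
  have hlogba : Real.log b - Real.log a = Real.log (1 + wd) - Real.log (1 - wd) := by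
    have h1 : 1 + wd = 2 * b / (b + a) := by rw [hwd]; field_simp; ring
    have h2 : 1 - wd = 2 * a / (b + a) := by rw [hwd]; field_simp; ring
    rw [h1, h2, Real.log_div (by positivity) (by positivity), Real.log_div (by positivity)
      (by positivity), Real.log_mul two_ne_zero hb.ne', Real.log_mul two_ne_zero ha.ne']
    ring
  have hlogqp : Real.log q - Real.log p = Real.log (1 + wD) - Real.log (1 - wD) := by
    have h1 : 1 + wD = 2 * q / (q + p) := by rw [hwD]; field_simp; ring
    have h2 : 1 - wD = 2 * p / (q + p) := by rw [hwD]; field_simp; ring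
    rw [h1, h2, Real.log_div (by positivity) (by positivity), Real.log_div (by positivity)
      (by positivity), Real.log_mul two_ne_zero hq.ne', Real.log_mul two_ne_zero hp.ne']
    ring
  have hτwD : τ * wD < 1 := by
    calc τ * wD ≤ 1 * wD := by gcongr
      _ < 1 := by rw [one_mul]; exact hwD1
  rw [hlogba, hlogqp]
  calc Real.log (1 + wd) - Real.log (1 - wd)
      ≤ Real.log (1 + τ * wD) - Real.log (1 - τ * wD) :=
        sub_le_sub (Real.log_le_log (by linarith) (by linarith))
          (Real.log_le_log (by linarith) (by linarith))
    _ ≤ τ * (Real.log (1 + wD) - Real.log (1 - wD)) :=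
        log_add_sub_log_sub_mul_le hτ0 hτ1 hwD0 hwD1

/-! ### Step B: elementary facts on `E_C(x,y)` and `δ_C` (Def. 2; proof of Thm 2.3, p. 7) -/

section Algebraic

variable {V : Type*} [AddCommGroup V] [Module ℂ V]

/-- `0 ∉ E_C(x,y)` when `y ∈ C` (Dubois 2009, remark after Def. 2). [cite: Dubois2009, Def. 2] -/
theorem zero_notMem_duboisE {C : Set V} (hC : IsComplexCone C) {x y : V} (hy : y ∈ C) :
    (0 : ℂ) ∉ duboisE C x y := by
  intro h
  apply h
  have : (0 : ℂ) • x - y = (-1 : ℂ) • y := by simp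
  rw [this]
  exact hC.2 (-1) (by norm_num) y hy

/-- A complex cone absorbs nonzero scalars: `k • v ∈ C ↔ v ∈ C` for `k ≠ 0`. [cite: Dubois2009, Def. 1] -/
theorem IsComplexCone.smul_mem_iff {C : Set V} (hC : IsComplexCone C) {k : ℂ} (hk : k ≠ 0)
    (v : V) : k • v ∈ C ↔ v ∈ C := by
  refine ⟨fun h => ?_, hC.2 k hk v⟩
  have := hC.2 k⁻¹ (inv_ne_zero hk) _ h
  rwa [smul_smul, inv_mul_cancel₀ hk, one_smul] at this

/-- The Möbius step of Dubois' proof (p. 7): if `α ∈ E_C(u,v)`, `λ ≠ μ` and `α ≠ λ`, then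
`(μ − α)/(λ − α) ∈ E_C(λu − v, μu − v)`, because
`w(λu − v) − (μu − v) = (w − 1)(αu − v)` for `w = (μ − α)/(λ − α)`.
[cite: Dubois2009, proof of Thm 2.3] -/
theorem div_mem_duboisE {C : Set V} (hC : IsComplexCone C) {u v : V} {α l m : ℂ}
    (hα : α ∈ duboisE C u v) (hlm : l ≠ m) (hαl : α ≠ l) :
    (m - α) / (l - α) ∈ duboisE C (l • u - v) (m • u - v) := by
  set w := (m - α) / (l - α) with hw
  have hla : l - α ≠ 0 := sub_ne_zero.2 (Ne.symm hαl)
  have hm : m = (l - α) * w + α := by rw [hw]; field_simp; ring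
  have hw1 : w - 1 ≠ 0 := by
    intro h
    have h1 : w = 1 := sub_eq_zero.1 h
    apply hlm
    rw [hm, h1]; ring
  have key : w • (l • u - v) - (m • u - v) = (w - 1) • (α • u - v) := by
    rw [hm]; module
  show w • (l • u - v) - (m • u - v) ∉ C
  rw [key, hC.smul_mem_iff hw1]
  exact hα

/-- For an independent pair, `z x − y ≠ 0`. [folklore] -/
theorem smul_sub_ne_zero_of_linearIndependent {x y : V} (h : LinearIndependent ℂ ![x, y])
    (z : ℂ) : z • x - y ≠ 0 := by
  intro h0
  have := (LinearIndependent.pair_iff.1 h) z (-1)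
    (by rw [neg_one_smul, ← sub_eq_add_neg]; exact h0)
  norm_num at this

/-- `λu − v, μu − v` are independent when `u, v` are and `λ ≠ μ`. [folklore] -/
theorem linearIndependent_smul_sub {u v : V} (h : LinearIndependent ℂ ![u, v]) {l m : ℂ}
    (hlm : l ≠ m) : LinearIndependent ℂ ![l • u - v, m • u - v] := by
  rw [LinearIndependent.pair_iff] at h ⊢
  intro s t hst
  have h' : (s * l + t * m) • u + (-(s + t)) • v = 0 := by rw [← hst]; module
  obtain ⟨h1, h2⟩ := h _ _ h'
  have ht : t = -s := by linear_combination -h2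
  subst ht
  have hs : s * (l - m) = 0 := by linear_combination h1
  rcases mul_eq_zero.1 hs with hs | hs
  · subst hs; simp
  · exact absurd (sub_eq_zero.1 hs) hlm

/-- Independence of `T x, T y` forces independence of `x, y`. [folklore] -/
theorem linearIndependent_of_map {W : Type*} [AddCommGroup W] [Module ℂ W] (T : V →ₗ[ℂ] W)
    {x y : V} (h : LinearIndependent ℂ ![T x, T y]) : LinearIndependent ℂ ![x, y] := by
  rw [LinearIndependent.pair_iff] at h ⊢
  intro s t hst
  exact h s t (by simpa using congrArg T hst)

/-- Unfolding `δ_C` on a colinear pair. [cite: Dubois2009, Def. 2] -/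
theorem duboisDelta_of_not_linearIndependent {C : Set V} {x y : V}
    (h : ¬ LinearIndependent ℂ ![x, y]) : duboisDelta C x y = 0 := by
  unfold duboisDelta
  exact if_neg h

/-- Unfolding `δ_C` on an independent pair. [cite: Dubois2009, Def. 2] -/
theorem duboisDelta_of_linearIndependent {C : Set V} {x y : V}
    (h : LinearIndependent ℂ ![x, y]) :
    duboisDelta C x y = ENNReal.log ((⨆ z ∈ duboisE C x y, (‖z‖₊ : ℝ≥0∞)) /
      (⨅ z ∈ duboisE C x y, (‖z‖₊ : ℝ≥0∞))) := by
  unfold duboisDelta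
  exact if_pos h

end Algebraic

/-- `|z| ≤ sup |E|` in `ℝ≥0∞`. [folklore] -/
theorem ofReal_norm_le_biSup {E : Set ℂ} {z : ℂ} (hz : z ∈ E) :
    ENNReal.ofReal ‖z‖ ≤ ⨆ w ∈ E, (‖w‖₊ : ℝ≥0∞) := by
  rw [ofReal_norm]
  exact le_iSup₂ (f := fun w (_ : w ∈ E) => (‖w‖₊ : ℝ≥0∞)) z hz

/-- `inf |E| ≤ |z|` in `ℝ≥0∞`. [folklore] -/
theorem biInf_le_ofReal_norm {E : Set ℂ} {z : ℂ} (hz : z ∈ E) :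
    ⨅ w ∈ E, (‖w‖₊ : ℝ≥0∞) ≤ ENNReal.ofReal ‖z‖ := by
  rw [ofReal_norm]
  exact iInf₂_le (f := fun w (_ : w ∈ E) => (‖w‖₊ : ℝ≥0∞)) z hz

section Normed

variable {V : Type*} [NormedAddCommGroup V] [NormedSpace ℂ V]

/-- Properness gives `E_C(x,y) ≠ ∅` for an independent pair (Dubois 2009, Def. 2: "by properness of
`C`, `E(x,y) ≠ ∅`"): otherwise the complex plane spanned by `x, y` lies in the closure of `C`.
[cite: Dubois2009, Def. 2] -/
theorem duboisE_nonempty {C : Set V} (hC : IsProperComplexCone C) {x y : V}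
    (hxy : LinearIndependent ℂ ![x, y]) : (duboisE C x y).Nonempty := by
  by_contra hE
  rw [Set.not_nonempty_iff_eq_empty] at hE
  have hall : ∀ z : ℂ, z • x - y ∈ C := fun z => by
    by_contra hz
    have : z ∈ duboisE C x y := hz
    rw [hE] at this
    exact this
  have hst : ∀ s t : ℂ, t ≠ 0 → s • x + t • y ∈ C := by
    intro s t ht
    have hs : (-t) * (-s / t) = s := by field_simp
    have : s • x + t • y = (-t) • ((-s / t) • x - y) := by
      rw [smul_sub, smul_smul, hs, neg_smul, sub_neg_eq_add]
    rw [this]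
    exact hC.1.2 (-t) (neg_ne_zero.2 ht) _ (hall _)
  apply hC.2 (Submodule.span ℂ (Set.range ![x, y]))
  · rw [finrank_span_eq_card hxy, Fintype.card_fin]
  · intro v hv
    rw [SetLike.mem_coe] at hv
    obtain ⟨c, rfl⟩ := (Submodule.mem_span_range_iff_exists_fun ℂ).1 hv
    simp only [Fin.sum_univ_two, Matrix.cons_val_zero, Matrix.cons_val_one]
    rcases eq_or_ne (c 1) 0 with h1 | h1
    · rw [h1, zero_smul, add_zero, Metric.mem_closure_iff]
      intro ε hε
      have hr : (0 : ℝ) < ε / (2 * (‖y‖ + 1)) := by positivity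
      refine ⟨c 0 • x + ((ε / (2 * (‖y‖ + 1)) : ℝ) : ℂ) • y, hst _ _ ?_, ?_⟩
      · exact_mod_cast hr.ne'
      · rw [dist_eq_norm, sub_add_cancel_left, norm_neg, norm_smul, Complex.norm_real,
          Real.norm_eq_abs, abs_of_pos hr]
        calc ε / (2 * (‖y‖ + 1)) * ‖y‖ ≤ ε / (2 * (‖y‖ + 1)) * (‖y‖ + 1) := by
              gcongr; exact le_add_of_nonneg_right zero_le_one
          _ = ε / 2 := by field_simp
          _ < ε := by linarith
    · exact subset_closure (hst _ _ h1)

/-- `δ_C(x,y) ≥ 0` for a proper cone and `y ∈ C` (`δ_C ∈ [0,∞]`, Def. 2). [cite: Dubois2009, Def. 2] -/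
theorem duboisDelta_nonneg {C : Set V} (hC : IsProperComplexCone C) {x y : V} (hy : y ∈ C) :
    0 ≤ duboisDelta C x y := by
  by_cases hxy : LinearIndependent ℂ ![x, y]
  · rw [duboisDelta_of_linearIndependent hxy, ENNReal.zero_le_log_iff]
    obtain ⟨z, hz⟩ := duboisE_nonempty hC hxy
    have hz0 : z ≠ 0 := fun h => zero_notMem_duboisE hC.1 hy (h ▸ hz)
    have hzpos : 0 < ENNReal.ofReal ‖z‖ := ENNReal.ofReal_pos.2 (norm_pos_iff.2 hz0)
    rw [ENNReal.le_div_iff_mul_le (Or.inr (hzpos.trans_le (ofReal_norm_le_biSup hz)).ne')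
      (Or.inl (ne_top_of_le_ne_top ENNReal.ofReal_ne_top (biInf_le_ofReal_norm hz))), one_mul]
    exact (biInf_le_ofReal_norm hz).trans (ofReal_norm_le_biSup hz)
  · rw [duboisDelta_of_not_linearIndependent hxy]

/-- Reading off `δ_C(u,v) ≤ Δ`: `|w₁| ≤ e^Δ |w₂|` for all `w₁, w₂ ∈ E_C(u,v)` (the use of
`δ_{C₂}(T(λx−y),T(μx−y)) ≤ Δ` in the proof of Thm 2.3, giving (2.12)). [cite: Dubois2009, (2.12)] -/
theorem norm_le_exp_mul_norm_of_duboisDelta_le {C : Set V} {u v : V}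
    (huv : LinearIndependent ℂ ![u, v]) {Δ : ℝ} (hΔ : duboisDelta C u v ≤ (Δ : EReal))
    {w₁ w₂ : ℂ} (h₁ : w₁ ∈ duboisE C u v) (h₂ : w₂ ∈ duboisE C u v) :
    ‖w₁‖ ≤ Real.exp Δ * ‖w₂‖ := by
  rw [duboisDelta_of_linearIndependent huv] at hΔ
  have hΔ' : (⨆ z ∈ duboisE C u v, (‖z‖₊ : ℝ≥0∞)) / (⨅ z ∈ duboisE C u v, (‖z‖₊ : ℝ≥0∞)) ≤
      ENNReal.ofReal (Real.exp Δ) := by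
    rw [← ENNReal.log_le_log_iff, ENNReal.log_ofReal_of_pos (Real.exp_pos Δ), Real.log_exp]
    exact hΔ
  rw [ENNReal.div_le_iff_le_mul (Or.inr ENNReal.ofReal_ne_top)
      (Or.inl (ne_top_of_le_ne_top ENNReal.ofReal_ne_top (biInf_le_ofReal_norm h₂)))] at hΔ'
  have key : ENNReal.ofReal ‖w₁‖ ≤ ENNReal.ofReal (Real.exp Δ) * ENNReal.ofReal ‖w₂‖ :=
    (ofReal_norm_le_biSup h₁).trans
      (hΔ'.trans (mul_le_mul_of_nonneg_left (biInf_le_ofReal_norm h₂) bot_le))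
  rw [← ENNReal.ofReal_mul (Real.exp_pos Δ).le, ENNReal.ofReal_le_ofReal_iff (by positivity)]
    at key
  exact key

end Normed

/-! ### Step C: Theorem 2.3 (pp. 7–8) -/

section MainProof

variable {V₁ V₂ : Type*} [NormedAddCommGroup V₁] [NormedSpace ℂ V₁]
  [NormedAddCommGroup V₂] [NormedSpace ℂ V₂]

/-- **Dubois 2009, Theorem 2.3** (contraction principle), universe-polymorphic form and without
the (unused) completeness assumptions: for proper complex cones `C₁ ⊆ V₁`, `C₂ ⊆ V₂`, a linear
`T` with `T(C₁ ∖ 0) ⊆ C₂ ∖ 0` and a real `Δ` bounding all `δ_{C₂}(Tx,Ty)`, `x, y ∈ C₁ ∖ 0`, one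
has `δ_{C₂}(Tx,Ty) ≤ tanh(Δ/4) δ_{C₁}(x,y)`. The proof is the printed one (pp. 7–8):
`E_{C₂}(Tx,Ty) ⊆ E_{C₁}(x,y)`; for `λ, μ ∉ E_{C₁}(x,y)` and `α, β ∈ E_{C₂}(Tx,Ty)` the Möbius map
`h(z) = (zλ − μ)/(z − 1)` gives (2.12) `|(μ−α)(λ−β)| ≤ e^Δ |(λ−α)(μ−β)|`; with `λ = mα/|α|`,
`μ = Mβ/|β|` on the circles `C(0,m)`, `C(0,M)` this is (2.13)
`(M−A)(B−m) ≤ e^Δ (A−m)(M−B)`, and the real-variable endgame is `log_sub_log_le_tanh_mul`.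
[cite: Dubois2009, Thm 2.3] -/
theorem duboisDelta_map_le_tanh_mul {C₁ : Set V₁} {C₂ : Set V₂}
    (hC₁ : IsProperComplexCone C₁) (hC₂ : IsProperComplexCone C₂) (T : V₁ →ₗ[ℂ] V₂)
    (hT : ∀ x ∈ C₁, x ≠ 0 → T x ∈ C₂ ∧ T x ≠ 0) {Δ : ℝ}
    (hΔ : ∀ x ∈ C₁, x ≠ 0 → ∀ y ∈ C₁, y ≠ 0 → duboisDelta C₂ (T x) (T y) ≤ (Δ : EReal))
    {x : V₁} (hx : x ∈ C₁) (hx0 : x ≠ 0) {y : V₁} (hy : y ∈ C₁) (hy0 : y ≠ 0) :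
    duboisDelta C₂ (T x) (T y) ≤ ((Real.tanh (Δ / 4) : ℝ) : EReal) * duboisDelta C₁ x y := by
  -- `Δ ≥ 0` since `δ(Tx,Tx) = 0 ≤ Δ`; the case `Δ = 0` is immediate.
  have hΔ0 : 0 ≤ Δ := by
    have h := hΔ x hx hx0 x hx hx0
    rw [duboisDelta_self] at h
    exact_mod_cast h
  rcases hΔ0.eq_or_lt with hΔz | hΔpos
  · subst hΔz
    rw [zero_div, Real.tanh_zero, EReal.coe_zero, zero_mul]
    exact_mod_cast hΔ x hx hx0 y hy hy0
  have hτpos : 0 < Real.tanh (Δ / 4) := tanh_pos_of_pos (by linarith)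
  have hτE : (0 : EReal) ≤ ((Real.tanh (Δ / 4) : ℝ) : EReal) := by exact_mod_cast hτpos.le
  -- "We may assume `Tx` and `Ty` linearly independent."
  by_cases hxy : LinearIndependent ℂ ![x, y]
  swap
  · have hTxy : ¬ LinearIndependent ℂ ![T x, T y] :=
      fun h => hxy (linearIndependent_of_map T h)
    rw [duboisDelta_of_not_linearIndependent hTxy, duboisDelta_of_not_linearIndependent hxy,
      mul_zero]
  by_cases hTxy : LinearIndependent ℂ ![T x, T y]
  swap
  · rw [duboisDelta_of_not_linearIndependent hTxy]
    exact EReal.mul_nonneg hτE (duboisDelta_nonneg hC₁ hy)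
  rw [duboisDelta_of_linearIndependent hTxy, duboisDelta_of_linearIndependent hxy]
  set E₁ := duboisE C₁ x y with hE₁
  set E₂ := duboisE C₂ (T x) (T y) with hE₂
  set S₁ := ⨆ z ∈ E₁, (‖z‖₊ : ℝ≥0∞) with hS₁
  set I₁ := ⨅ z ∈ E₁, (‖z‖₊ : ℝ≥0∞) with hI₁
  -- `E_{C₂}(Tx,Ty) ⊆ E_{C₁}(x,y)`.
  have hsub : E₂ ⊆ E₁ := by
    intro z hz
    show z • x - y ∉ C₁
    intro hzC
    have h1 := (hT _ hzC (smul_sub_ne_zero_of_linearIndependent hxy z)).1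
    apply hz
    show z • T x - T y ∈ C₂
    simpa using h1
  obtain ⟨β₀, hβ₀⟩ := duboisE_nonempty hC₂ hTxy
  have hβ₀0 : β₀ ≠ 0 := fun h => zero_notMem_duboisE hC₂.1 (hT y hy hy0).1 (h ▸ hβ₀)
  have hS₁0 : S₁ ≠ 0 :=
    ((ENNReal.ofReal_pos.2 (norm_pos_iff.2 hβ₀0)).trans_le (ofReal_norm_le_biSup (hsub hβ₀))).ne'
  have hI₁top : I₁ ≠ ⊤ :=
    ne_top_of_le_ne_top ENNReal.ofReal_ne_top (biInf_le_ofReal_norm (hsub hβ₀))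
  -- "and `δ_{C₁}(x,y) < ∞`": otherwise the right-hand side is `⊤`.
  by_cases hdeg : I₁ = 0 ∨ S₁ = ⊤
  · have htop : S₁ / I₁ = ⊤ := by
      rcases hdeg with h | h
      · rw [h]; exact ENNReal.div_zero hS₁0
      · rw [h]; exact ENNReal.top_div_of_ne_top hI₁top
    rw [htop, ENNReal.log_top, EReal.coe_mul_top_of_pos hτpos]
    exact le_top
  have hI₁0 : I₁ ≠ 0 := fun h => hdeg (Or.inl h)
  have hS₁top : S₁ ≠ ⊤ := fun h => hdeg (Or.inr h)
  set m₀ := I₁.toReal with hm₀def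
  set M₀ := S₁.toReal with hM₀def
  have hm₀ : 0 < m₀ := ENNReal.toReal_pos hI₁0 hI₁top
  have hlo : ∀ z ∈ E₁, m₀ ≤ ‖z‖ := fun z hz =>
    ENNReal.toReal_le_of_le_ofReal (norm_nonneg _) (biInf_le_ofReal_norm hz)
  have hhi : ∀ z ∈ E₁, ‖z‖ ≤ M₀ := fun z hz =>
    (ENNReal.ofReal_le_iff_le_toReal hS₁top).1 (ofReal_norm_le_biSup hz)
  have hmM : m₀ ≤ M₀ := (hlo β₀ (hsub hβ₀)).trans (hhi β₀ (hsub hβ₀))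
  have hM₀ : 0 < M₀ := hm₀.trans_le hmM
  -- The heart of the printed proof, (2.11)–(2.13) and the endgame, for `α, β ∈ E₂` with
  -- `|α| < |β|` and auxiliary radii `0 < m < inf |E₁|`, `sup |E₁| < M`.
  have key : ∀ α ∈ E₂, ∀ β ∈ E₂, ‖α‖ < ‖β‖ → ∀ m M : ℝ, 0 < m → m < m₀ → M₀ < M →
      Real.log ‖β‖ - Real.log ‖α‖ ≤ Real.tanh (Δ / 4) * (Real.log M - Real.log m) := by
    intro α hα β hβ hαβ m M hm hmm₀ hMM
    have hmA : m < ‖α‖ := hmm₀.trans_le (hlo α (hsub hα))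
    have hBM : ‖β‖ < M := (hhi β (hsub hβ)).trans_lt hMM
    have hA : 0 < ‖α‖ := hm.trans hmA
    have hB : 0 < ‖β‖ := hA.trans hαβ
    -- `λ ∈ C(0,m)` and `μ ∈ C(0,M)` lie in the complement of `E₁`; take them on the rays of
    -- `α` and `β`.
    set l : ℂ := ((m / ‖α‖ : ℝ) : ℂ) * α with hl
    set μ : ℂ := ((M / ‖β‖ : ℝ) : ℂ) * β with hμ
    have hMpos : 0 < M := hM₀.trans hMM
    have hl_norm : ‖l‖ = m := by
      rw [hl, norm_mul, Complex.norm_real, Real.norm_eq_abs, abs_of_pos (div_pos hm hA)]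
      exact div_mul_cancel₀ m hA.ne'
    have hμ_norm : ‖μ‖ = M := by
      rw [hμ, norm_mul, Complex.norm_real, Real.norm_eq_abs, abs_of_pos (div_pos hMpos hB)]
      exact div_mul_cancel₀ M hB.ne'
    have hl₁ : l • x - y ∈ C₁ := by
      by_contra h
      have h' := hlo l h
      rw [hl_norm] at h'
      linarith
    have hμ₁ : μ • x - y ∈ C₁ := by
      by_contra h
      have h' := hhi μ h
      rw [hμ_norm] at h'
      linarith
    have hlμ : l ≠ μ := by
      intro h
      have h' := congrArg norm h
      rw [hl_norm, hμ_norm] at h'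
      linarith
    have hαl : α ≠ l := by
      intro h
      have h' := congrArg norm h
      rw [hl_norm] at h'
      linarith
    have hβl : β ≠ l := by
      intro h
      have h' := congrArg norm h
      rw [hl_norm] at h'
      linarith
    -- (2.12), through the Möbius transformation `h(z) = (zλ − μ)/(z − 1)`.
    have hδ' : duboisDelta C₂ (l • T x - T y) (μ • T x - T y) ≤ (Δ : EReal) := by
      have h := hΔ _ hl₁ (smul_sub_ne_zero_of_linearIndependent hxy l) _ hμ₁
        (smul_sub_ne_zero_of_linearIndependent hxy μ)
      simpa using h
    have h212 := norm_le_exp_mul_norm_of_duboisDelta_le (linearIndependent_smul_sub hTxy hlμ)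
      hδ' (div_mem_duboisE hC₂.1 hα hlμ hαl) (div_mem_duboisE hC₂.1 hβ hlμ hβl)
    rw [norm_div, norm_div] at h212
    -- The four distances.
    have h1 : ‖l - α‖ = ‖α‖ - m := by
      have e : l - α = ((m / ‖α‖ - 1 : ℝ) : ℂ) * α := by rw [hl]; push_cast; ring
      rw [e, norm_mul, Complex.norm_real, Real.norm_eq_abs,
        abs_of_neg (by rw [sub_neg, div_lt_one hA]; exact hmA), neg_sub, sub_mul, one_mul,
        div_mul_cancel₀ m hA.ne']
    have h2 : ‖μ - β‖ = M - ‖β‖ := by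
      have e : μ - β = ((M / ‖β‖ - 1 : ℝ) : ℂ) * β := by rw [hμ]; push_cast; ring
      rw [e, norm_mul, Complex.norm_real, Real.norm_eq_abs,
        abs_of_pos (by rw [sub_pos, one_lt_div hB]; exact hBM), sub_mul, one_mul,
        div_mul_cancel₀ M hB.ne']
    have h3 : M - ‖α‖ ≤ ‖μ - α‖ := by
      have h' := norm_sub_norm_le μ α
      rwa [hμ_norm] at h'
    have h4 : ‖β‖ - m ≤ ‖l - β‖ := by
      have h' := norm_sub_norm_le β l
      rwa [hl_norm, norm_sub_rev] at h'
    have hpos1 : 0 < ‖l - α‖ := by rw [h1]; linarith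
    have hpos2 : 0 < ‖l - β‖ := by linarith
    -- (2.13).
    have h213 : (M - ‖α‖) * (‖β‖ - m) ≤ Real.exp Δ * ((‖α‖ - m) * (M - ‖β‖)) := by
      have hmul := mul_le_mul_of_nonneg_right h212 (mul_nonneg hpos1.le hpos2.le)
      have e1 : ‖μ - α‖ / ‖l - α‖ * (‖l - α‖ * ‖l - β‖) = ‖μ - α‖ * ‖l - β‖ := by
        field_simp
      have e2 : Real.exp Δ * (‖μ - β‖ / ‖l - β‖) * (‖l - α‖ * ‖l - β‖) =
          Real.exp Δ * (‖l - α‖ * ‖μ - β‖) := by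
        field_simp
      rw [e1, e2, h1, h2] at hmul
      calc (M - ‖α‖) * (‖β‖ - m) ≤ ‖μ - α‖ * ‖l - β‖ :=
            mul_le_mul h3 h4 (by linarith) (norm_nonneg _)
        _ ≤ _ := hmul
    -- The real-variable endgame, in square-root variables.
    have hsq := log_sub_log_le_tanh_mul (p := √m) (a := √‖α‖) (b := √‖β‖) (q := √M) (Δ := Δ)
      (Real.sqrt_pos.2 hm) (Real.sqrt_lt_sqrt hm.le hmA) (Real.sqrt_lt_sqrt hA.le hαβ)
      (Real.sqrt_lt_sqrt hB.le hBM) (by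
        simp only [Real.sq_sqrt hm.le, Real.sq_sqrt hA.le, Real.sq_sqrt hB.le,
          Real.sq_sqrt (hB.le.trans hBM.le)]
        exact h213)
    rw [Real.log_sqrt hm.le, Real.log_sqrt hA.le, Real.log_sqrt hB.le,
      Real.log_sqrt (hB.le.trans hBM.le)] at hsq
    linarith
  -- Let `m ↑ inf |E₁|`, `M ↓ sup |E₁|`; then take `sup_β`, `inf_α`.
  set K := Real.tanh (Δ / 4) * (Real.log M₀ - Real.log m₀) with hK
  have hK0 : 0 ≤ K := mul_nonneg hτpos.le (sub_nonneg.2 (Real.log_le_log hm₀ hmM))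
  have key' : ∀ α ∈ E₂, ∀ β ∈ E₂, ‖β‖ ≤ ‖α‖ * Real.exp K := by
    intro α hα β hβ
    have hA : 0 < ‖α‖ := hm₀.trans_le (hlo α (hsub hα))
    rcases le_or_gt ‖β‖ ‖α‖ with hle | hlt
    · calc ‖β‖ ≤ ‖α‖ * 1 := by rw [mul_one]; exact hle
        _ ≤ ‖α‖ * Real.exp K := mul_le_mul_of_nonneg_left (Real.one_le_exp hK0) (norm_nonneg _)
    have hB : 0 < ‖β‖ := hA.trans hlt
    have hlog : Real.log ‖β‖ - Real.log ‖α‖ ≤ K := by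
      refine le_of_forall_pos_lt_add fun ε hε => ?_
      set η := ε / (2 * Real.tanh (Δ / 4) + 2) with hη
      have hη0 : 0 < η := div_pos hε (by linarith)
      have h := key α hα β hβ hlt (m₀ * Real.exp (-η)) (M₀ * Real.exp η) (by positivity)
        (mul_lt_of_lt_one_right hm₀ (Real.exp_lt_one_iff.2 (by linarith)))
        (lt_mul_of_one_lt_right hM₀ (Real.one_lt_exp_iff.2 hη0))
      rw [Real.log_mul hM₀.ne' (Real.exp_pos _).ne', Real.log_exp,
        Real.log_mul hm₀.ne' (Real.exp_pos _).ne', Real.log_exp] at h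
      have hτη : 2 * Real.tanh (Δ / 4) * η < ε := by
        rw [hη, mul_div_assoc', div_lt_iff₀ (by linarith)]
        nlinarith
      calc Real.log ‖β‖ - Real.log ‖α‖
          ≤ Real.tanh (Δ / 4) * (Real.log M₀ + η - (Real.log m₀ + -η)) := h
        _ = K + 2 * Real.tanh (Δ / 4) * η := by rw [hK]; ring
        _ < K + ε := by linarith
    have h := Real.exp_le_exp.2 hlog
    rw [Real.exp_sub, Real.exp_log hB, Real.exp_log hA, div_le_iff₀ hA] at h
    linarith [mul_comm ‖α‖ (Real.exp K)]
  -- Conclusion.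
  have hfin : (⨆ z ∈ E₂, (‖z‖₊ : ℝ≥0∞)) / (⨅ z ∈ E₂, (‖z‖₊ : ℝ≥0∞)) ≤
      ENNReal.ofReal (Real.exp K) := by
    refine ENNReal.div_le_of_le_mul (iSup₂_le fun β hβ => ?_)
    rw [mul_comm, ← ENNReal.div_le_iff_le_mul
      (Or.inl (ENNReal.ofReal_pos.2 (Real.exp_pos K)).ne') (Or.inl ENNReal.ofReal_ne_top)]
    refine le_iInf₂ fun α hα => ENNReal.div_le_of_le_mul ?_
    calc (‖β‖₊ : ℝ≥0∞) = ENNReal.ofReal ‖β‖ := (ofReal_norm β).symm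
      _ ≤ ENNReal.ofReal (‖α‖ * Real.exp K) := ENNReal.ofReal_le_ofReal (key' α hα β hβ)
      _ = (‖α‖₊ : ℝ≥0∞) * ENNReal.ofReal (Real.exp K) := by
          rw [ENNReal.ofReal_mul (norm_nonneg _), ofReal_norm]; rfl
  calc ENNReal.log ((⨆ z ∈ E₂, (‖z‖₊ : ℝ≥0∞)) / (⨅ z ∈ E₂, (‖z‖₊ : ℝ≥0∞)))
      ≤ ENNReal.log (ENNReal.ofReal (Real.exp K)) := ENNReal.log_monotone hfin
    _ = (K : EReal) := by rw [ENNReal.log_ofReal_of_pos (Real.exp_pos K), Real.log_exp]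
    _ = ((Real.tanh (Δ / 4) : ℝ) : EReal) * ((Real.log M₀ - Real.log m₀ : ℝ) : EReal) := by
        rw [hK, EReal.coe_mul]
    _ = ((Real.tanh (Δ / 4) : ℝ) : EReal) * ENNReal.log (S₁ / I₁) := by
        rw [ENNReal.log_pos_real (ENNReal.div_pos_iff.2 ⟨hS₁0, hI₁top⟩).ne'
          (ENNReal.div_lt_top hS₁top hI₁0).ne, ENNReal.toReal_div,
          Real.log_div hM₀.ne' hm₀.ne']

end MainProof

/-- **Dubois 2009, Theorem 2.3 (contraction principle)** — discharge of the named fact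
`Dubois2009_thm_2_3` (statement unchanged in `ComplexConeContraction.lean`), by
`duboisDelta_map_le_tanh_mul`. [cite: Dubois2009, Thm 2.3] -/
theorem Dubois2009_thm_2_3_holds : Dubois2009_thm_2_3 := by
  intro V₁ V₂ _ _ _ _ _ _ C₁ C₂ hC₁ hC₂ T hT Δ hΔ x hx hx0 y hy hy0
  exact duboisDelta_map_le_tanh_mul hC₁ hC₂ T hT hΔ hx hx0 hy hy0

end Literature.Dynamics.Contraction

end
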